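import Summits.QuantumFields.BalabanUV.Beta.EriceFlowEnclosureB12AsPrintedHistoryNonuniqueBands
import Summits.QuantumFields.BalabanUV.Beta.EriceFlowEnclosureB12AsPrintedHistoryNonuniqueForward

/-!
# Beta / EriceFlowEnclosureB12AsPrintedHistoryNonuniqueBandsData — the DATA of the multi-band toy: one single-band data set
# (`toyData_exists`) per depth scale, targets g_m ↓ 0, band starts chosen RECURSIVELY so that the bands are disjoint and the deeper runs pass
# the earlier bands with couplings so small that those bands stay silent (SEPARATION) (β-flow team, prover 1 = recursion ∕ upper ∕
# bare-coupling ∕ UNIQUENESS side, unit `b2b-balaban-beta-bflow-p1`, gen 34; ROW AP-I·C × ROW U; parts: `…HistoryNonuniqueBands` (the banded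
# family, letters, runs given separation), `…HistoryNonuniqueForward` (`toyData_exists`), `…HistoryNonuniqueRuns` (the runs of one band))

HONEST FRAMING (page 1 of everything the β sub-cell writes): discharging `BetaPertH` makes Bałaban's UV stability UNCONDITIONAL — a
real constructive-QFT result; it is NOT the continuum limit and NOT the Clay problem.  HONEST DEPENDENCY (cell reorg 2026-08-19,
verbatim): «continuum YM on T⁴ ⇐ BetaPertH ∧ nine spine estimates (0/9 proved); BetaPertH ⇐ (D1) ∧ (D4) ∧ CAP+tail; G-an2-4 gates
asym, D1 and NE2/3/4.»  THIS MODULE DISCHARGES NOTHING: [folklore] arithmetic (a recursive choice of natural numbers and the square-root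
comparisons it buys) for a TOY FAMILY OF OURS; nothing of [I] = T. Bałaban, Commun. Math. Phys. **109** (1987) [Balaban1987RG1] is asserted.

THE RECURSION.  Targets g_m := min(γ, 1∕(m + 1)) (so g_m ≤ γ and g_m → 0).  Band m's data = `toyData_exists` at g = g_m with the FLOOR
N₀(m) := 2·n_{m−1} + ⌈9·x₀^{(m−1)}∕b⌉ (N₀(0) := 0), where x₀^{(m)} = 1∕g_m² + 2b·n_m is band m's start.  Consequences: 2n_m ≤ n_{m+1} (disjoint bands,
`…Bands` §28) and, for m′ < m, n_m − n_{m′} ≥ 9x₀^{(m′)}∕b, whence x₀^{(m)} − 2b·n_{m′} ≥ 9·x₀^{(m′)}: at the scales of band m′ (all < 2n_{m′}) the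
couplings of band m's runs are ≤ (x₀^{(m)} − 2b·n_{m′})^{−1∕2} ≤ gᴬ^{(m′)}_0∕3 — exactly the small box on which band m′'s bump VANISHES
(`bump_zero_of_smallBox` with `twoThirds_runB`): SEPARATION (§32), the hypothesis `hsil` of `rgEqH_of_bands_runA ∕ _runB`.

WHAT THIS FILE PROVES (0 sorry, 0 def):
§31 **`bandsData_exists`** (the sequences n_m, x₀^{(m)}, ε_m, M_m, τ_m, L_m, gᴬ^{(m)}, gᴮ^{(m)}, g_m with every per-band fact of `toyData_exists`,
    disjointness 2n_m ≤ n_{m+1}, n₀ ≥ 1, and the separation inequality 9x₀^{(m′)} ≤ x₀^{(m)} − 2b·n_{m′} for m′ < m).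
§32 `runA_small_at_earlier_band` (gᴬ^{(m)}_i ≤ gᴬ^{(m′)}_0∕3 for i ≤ 2n_{m′}, m′ < m), **`silent_runA`**, **`silent_runB`** (the earlier bands' bumps
    vanish along band m's runs: `hsil`), hence **`rgEqH_bands_runA ∕ rgEqH_bands_runB`** UNCONDITIONALLY for the data of §31.
NOT CLAIMED: anything about Bałaban's β; Theorem 2; `BetaPertH`; continuum; Clay.
-/

namespace Summit.QuantumFields.BalabanUV.Beta.EriceFlowEnclosureB12AsPrintedHistoryNonuniqueBandsData

open Finset
open Literature.MathematicalPhysics.QuantumFieldTheory.Balaban1983to89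
open Literature.MathematicalPhysics.QuantumFieldTheory.Balaban1983to89.FlowStep (HBeta prefixOf Box mem_box RGEqH)
open Summit.QuantumFields.BalabanUV.Beta.EriceFlowEnclosureB12AsPrintedHistoryNonunique (bump_zero_of_smallBox)
open Summit.QuantumFields.BalabanUV.Beta.EriceFlowEnclosureB12AsPrintedHistoryNonuniqueRuns (xA_pos gA_pos gB_le_gA twoThirds_runB)
open Summit.QuantumFields.BalabanUV.Beta.EriceFlowEnclosureB12AsPrintedHistoryNonuniqueForward (toyData_exists)
open Summit.QuantumFields.BalabanUV.Beta.EriceFlowEnclosureB12AsPrintedHistoryNonuniqueBands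

noncomputable section

/-! ## §31 The recursive data -/

/-- **THE DATA OF THE MULTI-BAND TOY.**  For b, C, C_p, γ > 0 there are sequences (n_m, x₀^{(m)}, ε_m, M_m, τ_m, L_m, gᴬ^{(m)}, gᴮ^{(m)}, g_m)_{m ∈ ℕ} with:
targets 0 < g_m ≤ min(γ, 1∕(m+1)); for EVERY m the facts of `toyData_exists` at g = g_m (the two runs of depth 2n_m from different bare couplings
ending at g_m, M_m > 0, ε_m∕M_m ≤ C, ε_m·L_m ≤ C, the smooth step's modulus L_m on [0, γ] and its value 1 along run B, the `BetaPertH` smallness,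
0 < ε_m ≤ min(b, 1)); DISJOINT BANDS 2n_m ≤ n_{m+1}, n₀ ≥ 1; and SEPARATION 9·x₀^{(m′)} ≤ x₀^{(m)} − b·(2n_{m′}) for m′ < m. [folklore] -/
theorem bandsData_exists {b C Cp γ : ℝ} (hb : 0 < b) (hC : 0 < C) (hCp : 0 < Cp) (hγ : 0 < γ) :
    ∃ (nb : ℕ → ℕ) (x0b εb Mb τb Lb gb : ℕ → ℝ) (gAb gBb : ℕ → ℕ → ℝ),
      1 ≤ nb 0 ∧ (∀ m, 2 * nb m ≤ nb (m + 1)) ∧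
      (∀ m m', m' < m → 9 * x0b m' ≤ x0b m - b * (2 * nb m')) ∧
      (∀ m, 0 < gb m ∧ gb m ≤ γ ∧ gb m ≤ 1 / ((m : ℝ) + 1)) ∧
      ∀ m, x0b m = 1 / gb m ^ 2 + b * (2 * nb m) ∧
        1 ≤ nb m ∧ 0 < εb m ∧ εb m ≤ 1 ∧ εb m ≤ b ∧ b * (2 * nb m) < x0b m ∧ 0 < x0b m ∧
        (∀ i, gAb m i = 1 / Real.sqrt (x0b m - b * i)) ∧
        (∀ i, gBb m i = 1 / Real.sqrt (x0b m - b * i + εb m * ((nb m - (i - nb m) : ℕ) : ℝ))) ∧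
        Mb m = ∑ i ∈ range (nb m), (gAb m i - gBb m i) ∧ 0 < Mb m ∧ εb m / Mb m ≤ C ∧ 0 ≤ Lb m ∧ εb m * Lb m ≤ C ∧ 0 < τb m ∧
        (∀ j, j ≤ 2 * nb m → Real.smoothTransition (gBb m j / τb m) = 1) ∧
        (∀ s t : ℝ, s ∈ Set.Icc (0 : ℝ) γ → t ∈ Set.Icc (0 : ℝ) γ →
          |Real.smoothTransition (s / τb m) - Real.smoothTransition (t / τb m)| ≤ Lb m * |s - t|) ∧
        εb m * nb m ≤ 5 / 4 * (x0b m - b * (2 * nb m)) ∧ εb m ≤ Cp * (gAb m 0 / 3) ^ 2 ∧ 0 < gAb m 0 / 3 ∧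
        gAb m (2 * nb m) = gb m := by
  -- the targets
  set gb : ℕ → ℝ := fun m => min γ (1 / ((m : ℝ) + 1)) with hgb
  have hgpos : ∀ m, 0 < gb m := fun m => lt_min hγ (by positivity)
  -- one single-band data set for every (m, floor)
  have key : ∀ (m N₀ : ℕ), ∃ (n : ℕ) (x₀ ε M τ L : ℝ) (gA gB : ℕ → ℝ),
      N₀ ≤ n ∧ x₀ = 1 / gb m ^ 2 + b * (2 * n) ∧
      1 ≤ n ∧ 0 < ε ∧ ε ≤ 1 ∧ ε ≤ b ∧ b * (2 * n) < x₀ ∧ 0 < x₀ ∧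
      (∀ i, gA i = 1 / Real.sqrt (x₀ - b * i)) ∧ (∀ i, gB i = 1 / Real.sqrt (x₀ - b * i + ε * ((n - (i - n) : ℕ) : ℝ))) ∧
      M = ∑ i ∈ range n, (gA i - gB i) ∧ 0 < M ∧ ε / M ≤ C ∧ 0 ≤ L ∧ ε * L ≤ C ∧ 0 < τ ∧
      (∀ j, j ≤ 2 * n → Real.smoothTransition (gB j / τ) = 1) ∧
      (∀ s t : ℝ, s ∈ Set.Icc (0 : ℝ) γ → t ∈ Set.Icc (0 : ℝ) γ →
        |Real.smoothTransition (s / τ) - Real.smoothTransition (t / τ)| ≤ L * |s - t|) ∧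
      ε * n ≤ 5 / 4 * (x₀ - b * (2 * n)) ∧ ε ≤ Cp * (gA 0 / 3) ^ 2 ∧ 0 < gA 0 / 3 ∧ gA (2 * n) = gb m :=
    fun m N₀ => toyData_exists (γ := γ) hb hC hCp (hgpos m) N₀
  choose nf x0f εf Mf τf Lf gAf gBf hspec using key
  -- the floors, recursively: N (m+1) = 2·n_m + ⌈9 x₀^{(m)}∕b⌉
  let N : ℕ → ℕ := fun m => Nat.rec (motive := fun _ => ℕ) 0 (fun m Nm => 2 * nf m Nm + ⌈9 * x0f m Nm / b⌉₊) m
  have hN : ∀ m, N (m + 1) = 2 * nf m (N m) + ⌈9 * x0f m (N m) / b⌉₊ := fun m => rfl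
  refine ⟨fun m => nf m (N m), fun m => x0f m (N m), fun m => εf m (N m), fun m => Mf m (N m), fun m => τf m (N m),
    fun m => Lf m (N m), gb, fun m => gAf m (N m), fun m => gBf m (N m), (hspec 0 (N 0)).2.2.1, fun m => ?_, ?_, fun m => ?_,
    fun m => (hspec m (N m)).2⟩
  · -- disjoint bands: n_{m+1} ≥ N(m+1) ≥ 2 n_m
    have h := (hspec (m + 1) (N (m + 1))).1
    have h2 := hN m
    show 2 * nf m (N m) ≤ nf (m + 1) (N (m + 1))
    omega
  · -- separation: for m' < m, n_m − n_{m'} ≥ 9 x₀^{(m')}∕b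
    intro m m' hm'
    show 9 * x0f m' (N m') ≤ x0f m (N m) - b * (2 * (nf m' (N m') : ℝ))
    -- monotonicity of the band starts from m'+1 to m
    have hmono : ∀ k, nf (m' + 1) (N (m' + 1)) ≤ nf (m' + 1 + k) (N (m' + 1 + k)) := by
      intro k
      induction k with
      | zero => exact le_rfl
      | succ k ih =>
        have h := (hspec (m' + 1 + k + 1) (N (m' + 1 + k + 1))).1
        have h2 := hN (m' + 1 + k)
        rw [show m' + 1 + (k + 1) = m' + 1 + k + 1 by omega]
        omega
    have hfloor : N (m' + 1) ≤ nf (m' + 1) (N (m' + 1)) := (hspec (m' + 1) (N (m' + 1))).1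
    have hfl2 := hN m'
    have hm : nf (m' + 1) (N (m' + 1)) ≤ nf m (N m) := by
      have := hmono (m - (m' + 1)); rwa [show m' + 1 + (m - (m' + 1)) = m by omega] at this
    have hceil : 9 * x0f m' (N m') / b ≤ (⌈9 * x0f m' (N m') / b⌉₊ : ℝ) := Nat.le_ceil _
    have hnat : 2 * nf m' (N m') + ⌈9 * x0f m' (N m') / b⌉₊ ≤ nf m (N m) := by omega
    have hreal : (2 * nf m' (N m') + ⌈9 * x0f m' (N m') / b⌉₊ : ℝ) ≤ (nf m (N m) : ℝ) := by exact_mod_cast hnat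
    have hx0m : x0f m (N m) = 1 / gb m ^ 2 + b * (2 * nf m (N m)) := (hspec m (N m)).2.1
    have hg2 : 0 < 1 / gb m ^ 2 := by have := hgpos m; positivity
    rw [hx0m]
    have h9 : 9 * x0f m' (N m') ≤ b * (⌈9 * x0f m' (N m') / b⌉₊ : ℝ) := by
      rw [← div_le_iff₀' hb]; exact hceil
    nlinarith [hreal, h9, hb]
  · exact ⟨hgpos m, min_le_left _ _, min_le_right _ _⟩

/-! ## §32 Separation: the earlier bands are silent along the deeper runs -/

/-- At the scales of an earlier band m′ < m, band m's free run has couplings ≤ gᴬ^{(m′)}_0∕3: for i ≤ 2n_{m′},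
gᴬ^{(m)}_i = (x₀^{(m)} − b·i)^{−1∕2} ≤ (x₀^{(m)} − 2b·n_{m′})^{−1∕2} ≤ (9x₀^{(m′)})^{−1∕2} = gᴬ^{(m′)}_0∕3. [folklore] -/
theorem runA_small_at_earlier_band {b x₀ x₀' : ℝ} {n' : ℕ} {gA gA' : ℕ → ℝ} (hb : 0 ≤ b)
    (hA : ∀ i, gA i = 1 / Real.sqrt (x₀ - b * i)) (hA' : ∀ i, gA' i = 1 / Real.sqrt (x₀' - b * i)) (hx₀' : 0 < x₀')
    (hsep : 9 * x₀' ≤ x₀ - b * (2 * n')) {i : ℕ} (hi : i ≤ 2 * n') : gA i ≤ gA' 0 / 3 := by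
  rw [hA i, hA' 0]
  push_cast
  rw [mul_zero, sub_zero]
  have hbi : b * (i : ℝ) ≤ b * (2 * n') := mul_le_mul_of_nonneg_left (by exact_mod_cast hi) hb
  have h9 : 9 * x₀' ≤ x₀ - b * i := by linarith
  have hpos : 0 < x₀ - b * i := by linarith
  have hs : Real.sqrt (9 * x₀') = 3 * Real.sqrt x₀' := by
    rw [show (9 : ℝ) * x₀' = 3 ^ 2 * x₀' by norm_num, Real.sqrt_mul' _ hx₀'.le, Real.sqrt_sq (by norm_num)]
  rw [show 1 / Real.sqrt x₀' / 3 = 1 / (3 * Real.sqrt x₀') by field_simp, ← hs]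
  exact one_div_le_one_div_of_le (Real.sqrt_pos.mpr (by linarith)) (Real.sqrt_le_sqrt h9)

/-- **THE EARLIER BANDS ARE SILENT ALONG BAND m's RUN A** (the hypothesis `hsil` of `rgEqH_of_bands_runA`), for the data of §31: at a scale
j of band m′ < m every coordinate of run A's prefix is ≤ gᴬ^{(m′)}_0∕3, on which box band m′'s bump vanishes (`bump_zero_of_smallBox` with
`twoThirds_runB`). [folklore] -/
theorem silent_runA {b : ℝ} {nb : ℕ → ℕ} {x0b εb Mb gb : ℕ → ℝ} {gAb gBb : ℕ → ℕ → ℝ} (hb : 0 < b)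
    (hsep2 : ∀ m, 2 * nb m ≤ nb (m + 1)) (hsep9 : ∀ m m', m' < m → 9 * x0b m' ≤ x0b m - b * (2 * nb m'))
    (hd : ∀ m, x0b m = 1 / gb m ^ 2 + b * (2 * nb m) ∧
        1 ≤ nb m ∧ 0 < εb m ∧ εb m ≤ 1 ∧ εb m ≤ b ∧ b * (2 * nb m) < x0b m ∧ 0 < x0b m ∧
        (∀ i, gAb m i = 1 / Real.sqrt (x0b m - b * i)) ∧
        (∀ i, gBb m i = 1 / Real.sqrt (x0b m - b * i + εb m * ((nb m - (i - nb m) : ℕ) : ℝ))) ∧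
        Mb m = ∑ i ∈ range (nb m), (gAb m i - gBb m i) ∧ 0 < Mb m ∧ εb m * nb m ≤ 5 / 4 * (x0b m - b * (2 * nb m)))
    {m : ℕ} : ∀ m', m' < m → ∀ j, nb m' ≤ j → j < 2 * nb m' →
      max (1 - |∑ i : Fin (j + 1), (if (i : ℕ) < nb m' then prefixOf (gAb m) j i - gBb m' i else 0)| / Mb m') 0 = 0 := by
  intro m' hm' j hj1 hj2
  obtain ⟨_, _, hε', _, _, hx', hx0', hA', hB', hM', hMpos', hΔ54'⟩ := hd m'
  obtain ⟨_, _, _, _, _, hx, _, hA, _, _, _, _⟩ := hd m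
  have hmm : nb m' ≤ nb m := nb_mono hsep2 hm'.le
  refine bump_zero_of_smallBox hM' hMpos' (twoThirds_runB hA' hB' hb.le hε'.le hx' hΔ54' le_rfl) (by omega) ?_
  refine mem_box.mpr fun i => ⟨?_, ?_⟩
  · simp only [FlowStep.prefixOf_apply]
    exact gA_pos hA hb.le hx (by have := i.isLt; omega)
  · simp only [FlowStep.prefixOf_apply]
    exact runA_small_at_earlier_band hb.le hA hA' hx0' (hsep9 m m' hm') (by have := i.isLt; omega)

/-- **THE EARLIER BANDS ARE SILENT ALONG BAND m's RUN B** (its couplings lie below run A's). [folklore] -/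
theorem silent_runB {b : ℝ} {nb : ℕ → ℕ} {x0b εb Mb gb : ℕ → ℝ} {gAb gBb : ℕ → ℕ → ℝ} (hb : 0 < b)
    (hsep2 : ∀ m, 2 * nb m ≤ nb (m + 1)) (hsep9 : ∀ m m', m' < m → 9 * x0b m' ≤ x0b m - b * (2 * nb m'))
    (hd : ∀ m, x0b m = 1 / gb m ^ 2 + b * (2 * nb m) ∧
        1 ≤ nb m ∧ 0 < εb m ∧ εb m ≤ 1 ∧ εb m ≤ b ∧ b * (2 * nb m) < x0b m ∧ 0 < x0b m ∧
        (∀ i, gAb m i = 1 / Real.sqrt (x0b m - b * i)) ∧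
        (∀ i, gBb m i = 1 / Real.sqrt (x0b m - b * i + εb m * ((nb m - (i - nb m) : ℕ) : ℝ))) ∧
        Mb m = ∑ i ∈ range (nb m), (gAb m i - gBb m i) ∧ 0 < Mb m ∧ εb m * nb m ≤ 5 / 4 * (x0b m - b * (2 * nb m)))
    {m : ℕ} : ∀ m', m' < m → ∀ j, nb m' ≤ j → j < 2 * nb m' →
      max (1 - |∑ i : Fin (j + 1), (if (i : ℕ) < nb m' then prefixOf (gBb m) j i - gBb m' i else 0)| / Mb m') 0 = 0 := by
  intro m' hm' j hj1 hj2
  obtain ⟨_, _, hε', _, _, hx', hx0', hA', hB', hM', hMpos', hΔ54'⟩ := hd m'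
  obtain ⟨_, _, hε, _, _, hx, _, hA, hB, _, _, _⟩ := hd m
  have hmm : nb m' ≤ nb m := nb_mono hsep2 hm'.le
  refine bump_zero_of_smallBox hM' hMpos' (twoThirds_runB hA' hB' hb.le hε'.le hx' hΔ54' le_rfl) (by omega) ?_
  refine mem_box.mpr fun i => ⟨?_, ?_⟩
  · simp only [FlowStep.prefixOf_apply]
    exact Summit.QuantumFields.BalabanUV.Beta.EriceFlowEnclosureB12AsPrintedHistoryNonuniqueRuns.gB_pos hB hb.le hε.le hx
      (by have := i.isLt; omega)
  · simp only [FlowStep.prefixOf_apply]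
    exact (gB_le_gA hA hB hb.le hε.le hx (by have := i.isLt; omega)).trans
      (runA_small_at_earlier_band hb.le hA hA' hx0' (hsep9 m m' hm') (by have := i.isLt; omega))

end

end Summit.QuantumFields.BalabanUV.Beta.EriceFlowEnclosureB12AsPrintedHistoryNonuniqueBandsData
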